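import Summits.QuantumFields.YangMills.Theorems.BalabanUVNodesN11NoExpansionTermFree

/-!
# DAG node N11 — (2.22)∕(3.24)'s OPERAND HALF AT ANY HISTORY: at a new sequence `s′` of length `k+1` with `Ω_{k+1}(s′) = ∅` the renormalized action (2.23) of
# record gains NO term — `A_{k+1}(s′)(U) = A_k(init s′)(U) + (E_k − E_{k+1})` for EVERY §2 setting, residual, term-value witness, fluctuation argument and
# configuration (the scale-(k+1) ranges of (2.26)–(2.27), (2.30), (2.41)(i) are empty, the coupling counterterm of (2.25) compensates (2.24) by r11's telescoping)

Cell `pub-ymgap`, YM-PLAN Track A (HUMAN RULING D-0062), seat `pub-ymgap-dag-n11-d` (g7; R134 fan-out seat N11 [B14], strategy s2), route `BalabanUVNodes`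
rev 21, item K1⁵ `StabilityBAtRecordR13SepCoP` = stmt-QuantumFields-20294 (helper, count-neutral).  [III] = [Balaban1988Convergent].  Sequel of this seat's
`BalabanUVNodesN11NoExpansionTermFree` (p495297: its §1 emptiness-of-ranges lemmas and, for the ALL-large-field history, the collapse to the bare Wilson action)
over r11's `B14.Eq225Concrete` ((2.23)–(2.25) WITH BODY: `wilsonLocal_add_E225`, the telescoping of (2.24)).

WHY THIS FILE.  `…NoExpansionAllLargeCoP` (p528220) proved the (S1ᵀ)₁₃CoP clause at the no-expansion new sequences of the ALL-large-field history, where both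
operands collapse to the bare Wilson action.  For a no-expansion top step over an ARBITRARY history (`Ω_{k+1}(s′) = ∅`, the earlier `Ω_j` anything) the
operands do not collapse, but they still AGREE: the level-(k+1) action of record at `s′` and the level-`k` action at `init s′`, evaluated with the SAME term
values and fluctuation argument, differ by the constant `E_k − E_{k+1}` — because `s′` and `init s′` have the same region FUNCTIONS (`Ω_{k+1} = Λ_{k+1} = ∅` is
also their off-window value), hence the same (2.19) tower and the same (2.26)–(2.27) ∕ (2.30) ∕ (2.41) ranges, the extra scale-(k+1) summands range over empty sets,
and r11's telescoping `−A(1∕g_n²(·),U) + 𝐄_n = −g₀⁻²A(U) + Σ_{j≤n}[E^{(j)} − E^{(j)}(1)]` removes the `n`-dependence of the localized Wilson term.  This is the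
operand half of «the old factors agree» ((3.24)) for the general no-expansion top step (the weight half is `…TkBranchLinearLocal`'s (L)+(SL), p527289), to be
assembled with `…ZetaSpecSucc` (p527502) when the locality of 12a″'s A-side weights on general regions is typed.

WHAT THIS FILE PROVES (0 `sorry`, 0 `def`, standard axioms; generic in `𝔸`, `V`, the numerics, the torus, ANY §2 setting `S` and residual `Rz`).
`seq_init_Ω_eq_of_Omega_empty` ∕ `seq_init_Λ_eq_of_Omega_empty` (`init s′` and `s′` have the same region functions); `EjSub_eq_zero_of_Λ_empty`,
`R230_succ_eq_of_Λ_empty`, `B240_succ_eq_of_Ω_empty` (the scale-(k+1) summands vanish); ★ `action23_succ_eq_init_of_Omega_empty`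
(`A_{k+1}(s′)(U) = A_k(init s′)(U) + (E_k − E_{k+1})`, `M ≥ 1`); `exp_action23_succ_eq_init_of_Omega_empty` (`e^{A_{k+1}(s′)} = e^{E_k−E_{k+1}}·e^{A_k(init s′)}`).

HONEST FRAMING.  Count-neutral kernel bookkeeping on r11's (2.23)–(2.25) with body; an identity of the tree's own action data, nothing of Bałaban's asserted (print:
(2.22) «for Ω_{k+1} = ∅ there are no new terms»).  N11 NOT discharged; counts unmoved (typed 28∕28 · discharged 5∕28).  One finite four-torus programme at fixed
`ε = L^{−K}`; NOT ℝ⁴, NOT OS, NOT a mass gap, NOT Clay.  Sources: [III] (2.22)–(2.27) pp. 258–259, (2.30) p. 260, (2.40)–(2.41) p. 261, (3.24) p. 270.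
-/

noncomputable section

open scoped BigOperators

namespace Summit.QuantumFields.YangMills.Theorems.BalabanUVNodesN11NoExpansionActionSucc

open Literature.MathematicalPhysics.QuantumFieldTheory.Balaban1983to89 T4Continuum Node00 Node00.Tk DagBinding
open BalabanUVNodesN11NoExpansionTermFree (admE_eq_false_of_Λ_empty admR_eq_false_of_Λ_empty admB_eq_false_of_Ω_empty)

variable {F : T4Family} {N : ℕ} [NeZero N]

section Generic

variable {𝔸 : Type*} [NormedRing 𝔸] [NormedAlgebra ℂ 𝔸] [CompleteSpace 𝔸] {V : Type*}
variable {ν : Stage7Numerics} {M : ℕ} {g : ℕ → ℝ} {K k : ℕ}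

omit [NeZero N] in
/-- **`init s′` AND `s′` HAVE THE SAME `Ω`-FUNCTION WHEN `Ω_{k+1}(s′) = ∅`** (on the window by `init`, at `k+1` by hypothesis, beyond by the off-window convention).
[cite: Balaban1988Convergent, (2.1) p.254 (bookkeeping)] -/
theorem seq_init_Ω_eq_of_Omega_empty (s : SeqOfRecord F ν M g K (k + 1)) (hΩ : s.Ω (k + 1) = ∅) : s.init.Ω = s.Ω := by
  funext j
  rcases Nat.lt_or_ge k j with hj | hj
  · rw [s.init.Ω_off j (fun h => absurd h.2 (not_le.mpr hj))]
    rcases Nat.lt_or_ge (k + 1) j with hj' | hj'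
    · exact (s.Ω_off j (fun h => absurd h.2 (not_le.mpr hj'))).symm
    · obtain rfl : j = k + 1 := le_antisymm hj' hj
      exact hΩ.symm
  · exact seq_init_Ω_of_le s hj

omit [NeZero N] in
/-- … and the same `Λ`-function (`Λ_{k+1} ⊆ Ω_{k+1} = ∅`). [cite: Balaban1988Convergent, (2.1) p.254 (bookkeeping)] -/
theorem seq_init_Λ_eq_of_Omega_empty (s : SeqOfRecord F ν M g K (k + 1)) (hΩ : s.Ω (k + 1) = ∅) : s.init.Λ = s.Λ := by
  have hΛ : s.Λ (k + 1) = ∅ := seq_Λ_eq_empty_of_Ω_eq_empty s hΩ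
  funext j
  rcases Nat.lt_or_ge k j with hj | hj
  · rw [s.init.Λ_off j (fun h => absurd h.2 (not_le.mpr hj))]
    rcases Nat.lt_or_ge (k + 1) j with hj' | hj'
    · exact (s.Λ_off j (fun h => absurd h.2 (not_le.mpr hj'))).symm
    · obtain rfl : j = k + 1 := le_antisymm hj' hj
      exact hΛ.symm
  · exact seq_init_Λ_of_le s hj

variable (S : Sect2.Setting 𝔸 (SU N)) (Rz : Sect2.Residual (F.P K) 𝔸)

/-- **THE VACUUM-SUBTRACTED 𝐄-SUM OF A SCALE WITH `Λ_j = ∅` VANISHES** (its (2.26)–(2.27) range is empty). [cite: Balaban1988Convergent, (2.25)–(2.27) p.259] -/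
theorem EjSub_eq_zero_of_Λ_empty {n : ℕ} (s : SeqOfRecord F ν M g K n) {j : ℕ} (hΛ : s.Λ j = ∅) (t : Sect2.TermValues (F.P K) 𝔸 V M)
    (U : GaugeField (F.P K) 0 (SU N)) :
    B14.Eq225Concrete.EjSub (Sect2.towerOfTerms S Rz M s.Ω t) (fun j X z => Sect2.admE (F.P K) ν M g s.Λ j (Sect2.domSites (F.P K) M j X) z) j U = 0 := by
  unfold B14.Eq225Concrete.EjSub
  simp only [admE_eq_false_of_Λ_empty s hΛ, Bool.false_eq_true, if_false, Finset.sum_const_zero]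

/-- **(2.30) GAINS NOTHING AT A SCALE WITH `Λ_{k+1} = ∅`**: `𝐑_{k+1} = 𝐑_k` on the same tower (`M ≥ 1`). [cite: Balaban1988Convergent, (2.30) p.260] -/
theorem R230_succ_eq_of_Λ_empty (hM : 1 ≤ M) {n : ℕ} (s : SeqOfRecord F ν M g K n) (hΛ : s.Λ (k + 1) = ∅) (t : Sect2.TermValues (F.P K) 𝔸 V M)
    (U : GaugeField (F.P K) 0 (SU N)) :
    B14.Eq225Concrete.R230 (Sect2.towerOfTerms S Rz M s.Ω t) (fun j X => Sect2.admR (F.P K) ν M g s.Λ j (Sect2.domSites (F.P K) M j X)) (k + 1) U =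
      B14.Eq225Concrete.R230 (Sect2.towerOfTerms S Rz M s.Ω t) (fun j X => Sect2.admR (F.P K) ν M g s.Λ j (Sect2.domSites (F.P K) M j X)) k U := by
  unfold B14.Eq225Concrete.R230
  rw [Finset.sum_Icc_succ_top (show 1 ≤ k + 1 by omega), add_eq_left]
  refine Finset.sum_eq_zero fun X _ => ?_
  have h := admR_eq_false_of_Λ_empty hM s hΛ X
  simp only [Sect2.towerOfTerms] at h ⊢
  rw [h]
  simp

/-- **(2.40) GAINS NOTHING AT A SCALE WITH `Ω_{k+1} = ∅`**: `𝐁_{k+1} = 𝐁_k` on the same tower, for every fluctuation argument. [cite: Balaban1988Convergent, (2.40)–(2.41) p.261] -/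
theorem B240_succ_eq_of_Ω_empty {n : ℕ} (s : SeqOfRecord F ν M g K n) (hΩ : s.Ω (k + 1) = ∅) (t : Sect2.TermValues (F.P K) 𝔸 V M)
    (a : Tk.SFluct (F.P K) V) (U : GaugeField (F.P K) 0 (SU N)) :
    B14.Eq225Concrete.B240 (Sect2.towerOfTerms S Rz M s.Ω t) (fun j X => Sect2.admB (F.P K) ν M g s.Ω s.Λ j (Sect2.domSites (F.P K) M j X)) a (k + 1) U =
      B14.Eq225Concrete.B240 (Sect2.towerOfTerms S Rz M s.Ω t) (fun j X => Sect2.admB (F.P K) ν M g s.Ω s.Λ j (Sect2.domSites (F.P K) M j X)) a k U := by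
  unfold B14.Eq225Concrete.B240
  rw [Finset.sum_Icc_succ_top (show 1 ≤ k + 1 by omega), add_eq_left]
  refine Finset.sum_eq_zero fun X _ => ?_
  have h := admB_eq_false_of_Ω_empty s hΩ (Sect2.domSites (F.P K) M (k + 1) X)
  simp only [Sect2.towerOfTerms] at h ⊢
  rw [h]
  simp

/-- **★ (2.22): NO NEW TERM AT A NO-EXPANSION TOP STEP, ANY HISTORY — `A_{k+1}(s′)(U) = A_k(init s′)(U) + (E_k − E_{k+1})`** for every §2 setting, residual,
term-value witness (the SAME on both sides), fluctuation argument and configuration, when `Ω_{k+1}(s′) = ∅` (`M ≥ 1`): same region functions ⇒ same tower and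
ranges; the scale-(k+1) summands of (2.25), (2.30), (2.40) are empty; r11's telescoping absorbs the change of the localized Wilson term.
[cite: Balaban1988Convergent, (2.22)–(2.25) pp.258–259, (2.30) p.260, (2.40)–(2.41) p.261, (3.24) p.270] -/
theorem action23_succ_eq_init_of_Omega_empty (hM : 1 ≤ M) (s : SeqOfRecord F ν M g K (k + 1)) (hΩ : s.Ω (k + 1) = ∅)
    (t : Sect2.TermValues (F.P K) 𝔸 V M) (a : Tk.SFluct (F.P K) V) (E E' : ℝ) (U : GaugeField (F.P K) 0 (SU N)) :
    (sect2ActionDataOfRecord F N V K S Rz s t a E').action23 (k + 1) U =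
      (sect2ActionDataOfRecord F N V K S Rz s.init t a E).action23 k U + (E - E') := by
  have hΛ : s.Λ (k + 1) = ∅ := seq_Λ_eq_empty_of_Ω_eq_empty s hΩ
  show (Sect2.actionDataOfTerms S Rz ν M g s.Ω s.Λ t (k + 1) a E').action23 (k + 1) U =
    (Sect2.actionDataOfTerms S Rz ν M g s.init.Ω s.init.Λ t k a E).action23 k U + (E - E')
  rw [seq_init_Ω_eq_of_Omega_empty s hΩ, seq_init_Λ_eq_of_Omega_empty s hΩ, Sect2.action23_actionDataOfTerms, Sect2.action23_actionDataOfTerms]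
  have hW : ∀ n : ℕ, -B14.Eq225Concrete.smearedWilson (B14.LocalCoupling.invSq S.flow Rz.phi n) U +
      B14.Eq225Concrete.E225 (Sect2.towerOfTerms S Rz M s.Ω t) (fun j X z => Sect2.admE (F.P K) ν M g s.Λ j (Sect2.domSites (F.P K) M j X) z) Rz.phi n U =
      -(1 / (S.flow.g 0) ^ 2 * wilsonAction4 U) +
        ∑ j ∈ Finset.Icc 1 n, B14.Eq225Concrete.EjSub (Sect2.towerOfTerms S Rz M s.Ω t)
          (fun j X z => Sect2.admE (F.P K) ν M g s.Λ j (Sect2.domSites (F.P K) M j X) z) j U :=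
    fun n => B14.Eq225Concrete.wilsonLocal_add_E225 (Sect2.towerOfTerms S Rz M s.Ω t) _ Rz.phi n U
  rw [hW (k + 1), hW k, R230_succ_eq_of_Λ_empty S Rz hM s hΛ t U, B240_succ_eq_of_Ω_empty S Rz s hΩ t a U,
    Finset.sum_Icc_succ_top (show 1 ≤ k + 1 by omega), EjSub_eq_zero_of_Λ_empty S Rz s hΛ t U]
  ring

/-- **`e^{A_{k+1}(s′)} = e^{E_k − E_{k+1}}·e^{A_k(init s′)}`** at a no-expansion top step, any history (same witness, same fluctuation argument).
[cite: Balaban1988Convergent, (2.22)–(2.23) p.258, (3.24) p.270] -/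
theorem exp_action23_succ_eq_init_of_Omega_empty (hM : 1 ≤ M) (s : SeqOfRecord F ν M g K (k + 1)) (hΩ : s.Ω (k + 1) = ∅)
    (t : Sect2.TermValues (F.P K) 𝔸 V M) (a : Tk.SFluct (F.P K) V) (E E' : ℝ) (U : GaugeField (F.P K) 0 (SU N)) :
    Real.exp ((sect2ActionDataOfRecord F N V K S Rz s t a E').action23 (k + 1) U) =
      Real.exp (E - E') * Real.exp ((sect2ActionDataOfRecord F N V K S Rz s.init t a E).action23 k U) := by
  rw [action23_succ_eq_init_of_Omega_empty S Rz hM s hΩ t a E E' U, ← Real.exp_add]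
  congr 1
  ring

end Generic

end Summit.QuantumFields.YangMills.Theorems.BalabanUVNodesN11NoExpansionActionSucc

end
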